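import Literature.AlgebraicGeometry.AbelianSchemes.DualPairHatRelDimTransport      -- ★ FILE 1 p847130 ((s2-D) glue, letter-free transport kit)
import Literature.AlgebraicGeometry.AbelianSchemes.DualAbelianSchemeExistsLetter   -- ★ P-2′ «DUAL-S» letter p847133 (`dualAbelianSchemeExists`, `dualPairOf`)
import HarnessLib

/-!
# Under PRINTED ROW P-2′ «DUAL-S»: EVERY dual pair of an abelian scheme of relative dimension `g` has a dual of relative dimension `g`,
# and `dim Â_s = dim A_s` at EVERY field-valued point for EVERY dual pair — with the W-line's iterated-base-change binder `hdim`

Topic `AlgebraicGeometry/AbelianSchemes`; namespace `Literature.AlgebraicGeometry.AbelianSchemes.AbelianSchemeOver(.DualPair)`.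
THEOREMS ONLY (no definition, no structure, no instance, no named fact, no `sorry`); books 0; universe `0` (as the letter).

Cell hodgecm-mathlib (D-0151), P6 «MOD programme», **(s2-D) GLUE over the P-2′ «DUAL-S» letter, FILE 2 of 2** (LEAD F0P6-plan (g2) RULING
«M-29 — DUAL-S NOW» 2026-09-01T22:44:56Z (3)∕(5); director s1096 (2); B-p04 (g40) heir by lineage).  With ★ `dualAbelianSchemeExists`
(`DualAbelianSchemeExistsLetter.lean` p847133, desk F0P6a-plan (g3)) the stage dual pair of the GEN spine is ONE token
`dual := dualPairOf hDUALS univ` (★ `dualPairOf`; its `universal` is a field of ★ `DualPair`), and clause (ii) of the letter gives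
`(dualPairOf hDUALS univ).hat.IsOfRelDim g` for THAT chosen dual.  FILE 1 (★ `DualPairHatRelDimTransport` p847130, letter-free) transports
`IsOfRelDim` between any two dual pairs of one abelian scheme; this file combines the two, all under `h : dualAbelianSchemeExists` BY NAME:
* **`DualPair.isOfRelDim_hat_of_dualAbelianSchemeExists (h) (D : A.DualPair) (hA : A.IsOfRelDim g) : D.hat.IsOfRelDim g`** — EVERY dual
  pair (clause (ii) for the chosen dual ★ `dualPairOf_hat_isOfRelDim`, transported by ★ `DualPair.isOfRelDim_hat_of_dualPair`), so the GEN
  spine may keep `dual` an ARBITRARY binder of `RGDInputsAt`∕`ModuliDatum` (or use ★ `DualPair.normalize`, whose `hat` is the same) and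
  still read clause (ii);
* **`DualPair.dim_hat_fibre_eq_of_dualAbelianSchemeExists (h) (D) (s) : (D.hat.fibre s).toAbelianVariety.dim = (A.fibre s).toAbelianVariety.dim`**
  — at EVERY field-valued point `s` of ANY base for ANY dual pair, with NO relative-dimension hypothesis on `A` (base change the dual pair to
  the point, ★ `DualPair.baseChange`, `(D.baseChange s).hat = Â ×_S Spec Ω` definitionally; over a field `A_s` has relative dimension
  `dim A_s`, ★ `isOfRelDim_dim_toAffine`);
* **`DualPair.dim_hat_baseChange_baseChange_eq_of_dualAbelianSchemeExists (h) (D) (f) (x)`** — the W-line's LITERAL binder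
  `hdim : D′.hat.toAffine.toAbelianVariety.dim = A′.dim` at the P6 special fibre `A′ := ((univ.baseChange ι_s).baseChange x̄).toAffine.toAbelianVariety`,
  `D′ := (dual.baseChange ι_s).baseChange x̄` = the Defs helper `dual₀Of 𝓜 w univ dual x̄` ON THE NOSE (★ `DualPair.dim_hat_baseChange_baseChange_eq`
  packaging), for every dual pair, every `f`, every field point `x`; `…_baseChange_eq_…` one base change deep; over a field
  `DualPair.dim_hat_toAbelianVariety_eq_of_dualAbelianSchemeExists`;
* the `dualPairOf` specialisation `dualPairOf_dim_hat_fibre_eq` and the binder form `exists_dualPair_forall_dim_hat_fibre_eq`.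
This retires, on the road of record, the (W-hdim) supplier's need for a characteristic-zero witness point + connectedness + polarisation
(★ `DualPairFibreDimOfConnectedStage` §3) — both routes stay ★; the unconditional `dim Â = dim A` over a field ((σ1-g), B-p08) is the
stronger pay-down when it lands.  HC_CM is proved only modulo the printed citations (2 remaining named inputs hLiu418 24832, h413 24833)
until rung 0 closes; this file is count-neutral and discharges none of them (every theorem is CONDITIONAL on the booked printed row P-2′,
taken as the hypothesis `h : dualAbelianSchemeExists` BY NAME — no restatement).

## References
* [GortzWedhorn2023] U. Görtz, T. Wedhorn, *Algebraic Geometry II* (2023), Thm. 27.198 (2) (pp. 679–680) «`X^t` is representable by an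
  abelian scheme with `dim(X^t∕S) = dim(X∕S)`», Remark 27.218 (1) (p. 689) (compatibility of the Poincaré bundle with base change),
  Cor. 27.212 (pp. 685–686) (existence).
* [MilneAV2008] J. S. Milne, *Abelian Varieties* (v2.00, 2008), I §8 pp. 36–37 (the dual pair is unique up to a unique isomorphism),
  Rem. 8.8 («`dim A^∨ = dim A`»).
* [MumfordAV1970] D. Mumford, *Abelian Varieties* (1970), §13 Cor. 3 (p. 130) and Thm. p. 125.
* [MumfordFogartyKirwan1994] D. Mumford, J. Fogarty, F. Kirwan, *Geometric Invariant Theory*, 3rd ed. (1994), Ch. 6 §1 Cor. 6.8 (p. 118),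
  Ch. 7 §2 Definition 7.2 (p. 129) (relative dimension of an abelian scheme).
* [GortzWedhorn2020] U. Görtz, T. Wedhorn, *Algebraic Geometry I*, 2nd ed. (2020), Remark 16.54 (p. 539) / (p. 678) (relative dimension,
  fibres), Section (4.7) (base change).
* Tree: ★ `DualPairHatRelDimTransport` (p847130: `DualPair.isOfRelDim_hat_of_dualPair`, `isOfRelDim_dim_toAffine`,
  `dim_toAffine_toAbelianVariety_of_isOfRelDim`, `DualPair.dim_hat_toAbelianVariety_eq_of_isOfRelDim`), ★ `DualAbelianSchemeExistsLetter`
  (p847133: `dualAbelianSchemeExists`, `dualPairOf`, `dualPairOf_hat_isOfRelDim`), ★ `AbelianSchemeDualPairBaseChange` (`DualPair.baseChange`,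
  `baseChange_hat`), ★ `DualPairFibreDimOfConnectedStage` (`DualPair.dim_hat_baseChange_baseChange_eq`, `DualPair.dim_hat_baseChange_eq`).
-/

set_option autoImplicit false

noncomputable section

open CategoryTheory CategoryTheory.Limits AlgebraicGeometry

namespace Literature.AlgebraicGeometry.AbelianSchemes

namespace AbelianSchemeOver

/-! ### Under PRINTED ROW P-2′ «DUAL-S» (`dualAbelianSchemeExists`, universe `0`): every dual pair, every field point -/

section UnderDualExists

variable {S : Scheme.{0}}

/-- **Under P-2′ «DUAL-S», EVERY dual pair `D = (Â, 𝒫)` of an abelian scheme `A` of relative dimension `g` has `Â` of relative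
dimension `g`** — clause (ii) «`dim(X^t∕S) = dim(X∕S)`» of the letter for the chosen dual (★ `dualPairOf_hat_isOfRelDim`) transported to
`D` by uniqueness of duals (★ FILE 1 `DualPair.isOfRelDim_hat_of_dualPair`). [cite: GortzWedhorn2023, Thm. 27.198 (2) (pp. 679–680); Cor. 27.212 (pp. 685–686)] [cite: MilneAV2008, I §8 pp. 36–37] -/
theorem DualPair.isOfRelDim_hat_of_dualAbelianSchemeExists (h : dualAbelianSchemeExists) {A : AbelianSchemeOver S} (D : A.DualPair)
    {g : ℕ} (hA : A.IsOfRelDim g) : D.hat.IsOfRelDim g :=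
  DualPair.isOfRelDim_hat_of_dualPair (dualPairOf h A) D (dualPairOf_hat_isOfRelDim h A hA)

/-- **Under P-2′ «DUAL-S», `dim Â_s = dim A_s` at EVERY field-valued point `s` of ANY base, for EVERY dual pair** — no relative-dimension,
connectedness or characteristic hypothesis: base change the dual pair to the point (★ `DualPair.baseChange`, `(D.baseChange s).hat = Â_s`
definitionally), where `A_s → Spec Ω` has relative dimension `dim A_s` (★ `isOfRelDim_dim_toAffine`), and apply the previous theorem over `Spec Ω`.
[cite: MumfordAV1970, §13 Cor. 3 (p. 130)] [cite: GortzWedhorn2023, Thm. 27.198 (2) (pp. 679–680); Remark 27.218 (1) (p. 689)] -/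
theorem DualPair.dim_hat_fibre_eq_of_dualAbelianSchemeExists (h : dualAbelianSchemeExists) {A : AbelianSchemeOver S} (D : A.DualPair)
    {Ω : Type} [Field Ω] (s : Spec (.of Ω) ⟶ S) :
    (D.hat.fibre s).toAbelianVariety.dim = (A.fibre s).toAbelianVariety.dim := by
  have hA : (A.baseChange s).IsOfRelDim (A.fibre s).toAbelianVariety.dim := isOfRelDim_dim_toAffine (A.baseChange s)
  have hD : (D.baseChange s).hat.IsOfRelDim (A.fibre s).toAbelianVariety.dim :=
    DualPair.isOfRelDim_hat_of_dualAbelianSchemeExists h (D.baseChange s) hA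
  exact dim_toAffine_toAbelianVariety_of_isOfRelDim hD

/-- **The W-line's literal binder `hdim` under P-2′ «DUAL-S»**: for every dual pair `D` of `A → S`, every `f : T → S` and every field point
`x` of `T`, `dim` of the dual in the ITERATED base change `(D ×_S T) ×_T Spec k` equals `dim ((A ×_S T) ×_T Spec k)` in the
`toAffine.toAbelianVariety` currency — at `f := ι_s`, `x := x̄` this is `(dual₀Of 𝓜 w univ dual x̄).hat.toAffine.toAbelianVariety.dim =
(fibre₀Of 𝓜 w univ x̄).dim` ON THE NOSE (★ `DualPair.dim_hat_baseChange_baseChange_eq` packaging of the fibre statement at `x ≫ f`).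
[cite: MumfordFogartyKirwan1994, Ch. 6 §1 Cor. 6.8 (p. 118)] [cite: MumfordAV1970, §13 Cor. 3 (p. 130)] -/
theorem DualPair.dim_hat_baseChange_baseChange_eq_of_dualAbelianSchemeExists (h : dualAbelianSchemeExists) {A : AbelianSchemeOver S}
    (D : A.DualPair) {T : Scheme.{0}} (f : T ⟶ S) {k : Type} [Field k] (x : Spec (.of k) ⟶ T) :
    ((D.baseChange f).baseChange x).hat.toAffine.toAbelianVariety.dim =
      ((A.baseChange f).baseChange x).toAffine.toAbelianVariety.dim :=
  D.dim_hat_baseChange_baseChange_eq f x (DualPair.dim_hat_fibre_eq_of_dualAbelianSchemeExists h D (x ≫ f))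

/-- One base change deep: `dim (D.baseChange x).hat = dim (A.baseChange x)` in the `toAffine.toAbelianVariety` currency, every dual pair,
every field point. [cite: MumfordAV1970, §13 Cor. 3 (p. 130)] -/
theorem DualPair.dim_hat_baseChange_eq_of_dualAbelianSchemeExists (h : dualAbelianSchemeExists) {A : AbelianSchemeOver S}
    (D : A.DualPair) {k : Type} [Field k] (x : Spec (.of k) ⟶ S) :
    (D.baseChange x).hat.toAffine.toAbelianVariety.dim = (A.baseChange x).toAffine.toAbelianVariety.dim :=
  D.dim_hat_baseChange_eq x (DualPair.dim_hat_fibre_eq_of_dualAbelianSchemeExists h D x)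

/-- Over a field, every dual pair: `dim Â = dim A` (`toAffine.toAbelianVariety` currency) under P-2′. [cite: MumfordAV1970, §13 Cor. 3 (p. 130)] -/
theorem DualPair.dim_hat_toAbelianVariety_eq_of_dualAbelianSchemeExists (h : dualAbelianSchemeExists) {K : Type} [Field K]
    {A : AbelianSchemeOver (Spec (.of K))} (D : A.DualPair) :
    D.hat.toAffine.toAbelianVariety.dim = A.toAffine.toAbelianVariety.dim :=
  DualPair.dim_hat_toAbelianVariety_eq_of_isOfRelDim D (isOfRelDim_dim_toAffine A)
    (DualPair.isOfRelDim_hat_of_dualAbelianSchemeExists h D (isOfRelDim_dim_toAffine A))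

/-- The CHOSEN dual pair `dualPairOf h A`: `dim Â_s = dim A_s` at every field point (no hypothesis on `A`).
[cite: GortzWedhorn2023, Thm. 27.198 (2) (pp. 679–680); Cor. 27.212 (pp. 685–686)] -/
theorem dualPairOf_dim_hat_fibre_eq (h : dualAbelianSchemeExists) (A : AbelianSchemeOver S) {Ω : Type} [Field Ω]
    (s : Spec (.of Ω) ⟶ S) :
    ((dualPairOf h A).hat.fibre s).toAbelianVariety.dim = (A.fibre s).toAbelianVariety.dim :=
  DualPair.dim_hat_fibre_eq_of_dualAbelianSchemeExists h (dualPairOf h A) s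

/-- Existence form for consumers that take the dual pair as a binder together with `hdim` at all field points: under P-2′ every
abelian scheme has a dual pair `D` with `dim Â_s = dim A_s` for all `s`. [cite: GortzWedhorn2023, Cor. 27.212 (pp. 685–686); Thm. 27.198 (2) (pp. 679–680)] -/
theorem exists_dualPair_forall_dim_hat_fibre_eq (h : dualAbelianSchemeExists) (A : AbelianSchemeOver S) :
    ∃ D : A.DualPair, ∀ (Ω : Type) [Field Ω] (s : Spec (.of Ω) ⟶ S),
      (D.hat.fibre s).toAbelianVariety.dim = (A.fibre s).toAbelianVariety.dim :=
  ⟨dualPairOf h A, fun _ _ s => dualPairOf_dim_hat_fibre_eq h A s⟩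

end UnderDualExists

end AbelianSchemeOver

end Literature.AlgebraicGeometry.AbelianSchemes

end
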